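import Literature.NumberTheory.EllipticCurves.ComplexMultiplicationDeuring1728Proofs
import HarnessLib

/-!
# Frobenius traces of the elliptic curves with `j = 1728`: `a_p = 0` at `p ≡ 3 (4)` and
# `a_p² − 2p = (3c₄/p) · 2 Re(π²)` at `p ≡ 1 (4)`, `p = N(π)`, `π` primary

Topic `NumberTheory/EllipticCurves`; sibling proof file (theorems only) of
`ComplexMultiplicationDeuring1728Proofs` (Deuring's `a_p = π + π̄` for `j = 1728` from
Ireland–Rosen, Ch. 18 §4 Thm. 5). For the symmetric square of the newform of such a curve one needs
slightly more than "some `π` with `ππ̄ = p`": the SQUARE `a_p²` in terms of the PRIMARY prime `π` of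
norm `p` and of a GLOBAL invariant of the curve. Ireland–Rosen's Theorem 18.5 gives, for the reduction
`y² = x³ − Dx` (`p ∤ D`) of a globally minimal `W` with `j(W) = 1728` at a good prime `p ≥ 5`:

* `p ≡ 3 (mod 4)`: `N_p = p + 1`, i.e. **`a_p(W) = 0`** (`frobeniusTrace_eq_zero_of_j_eq_of_mod_four_eq_three`);
* `p ≡ 1 (mod 4)`, `p = N(π)`, `π ≡ 1 (2 + 2i)`: `a_p(W) = \overline{χ_π(D)} π + χ_π(D) π̄` with the
  quartic residue character `χ_π`, whence, squaring and using `χ_π² = (·/p)` (`GaussianQuartic.chi_sq`),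
  `a_p(W)² = (D/p)(π² + π̄²) + 2p`; and `D ≡ c₄(W)/48 (mod p)` for the `c₄`-invariant of the minimal
  model (`exists_natCard_reduction_eq_of_j_eq'`: Mathlib's `toShortNF` has `u = 1`, so it preserves
  `c₄`, and `c₄ = −48 a₄` in short Weierstrass form), so `(D/p) = (3c₄(W)/p)`:
  **`a_p(W)² = 2 (3c₄(W)/p) Re(π²) + 2p`** (`frobeniusTrace_sq_of_j_eq_of_mod_four_eq_one`).

In other words `a_p² − 2p` — the `p`-th coefficient of `L(Sym² W, s)` shifted to weight `0` — is the
value at the primes over `p` of the Grössencharakter `λ_W(𝔞) = (3c₄(W)/N𝔞)(α/|α|)²` of `ℚ(i)`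
(`α` the primary generator), the input of `L(Sym² f_W, s) = L(s, χ₋₄) L(s, λ_W)` for this CM family.

## References

* K. Ireland, M. Rosen, *A Classical Introduction to Modern Number Theory*, GTM 84, 2nd ed. (1990),
  Ch. 18 §4 Theorem 5 (both assertions), Ch. 9 §8 (the quartic character). [cite: IrelandRosen1990, Ch. 18 §4, Theorem 5]
* M. Deuring, Abh. Math. Sem. Univ. Hamburg 14 (1941), 197–272. [cite: Deuring1941]

## Mathlib / tree search

Tree: `exists_natCard_reduction_eq_of_j_eq` (weaker: no relation of `D` to `c₄`; re-proved here with
it), `c₄_pow_three_eq_of_j_eq`, `a₆_eq_zero_of_j_eq`, `IrelandRosen1990_card_points_one_mod_four_holds`,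
`IrelandRosen1990_card_points_three_mod_four`, `GaussianQuartic.{chi, chi_sq, rho_apply, isUnit_chi,
chi_eq_iff, dvd_of_red_eq_zero, two_ne_zero_of_one_mod_four}`, `GaussianPrimary.{eq_of_isUnit,
IsPrimary, isPrimary_iff_dvd}`, `frobeniusTrace`, `reductionPointCount`. Mathlib:
`WeierstrassCurve.toShortNF`, `variableChange_c₄`, `c₄_of_isShortNF`, `legendreSym.mul`,
`legendreSym.sq_one'`.
-/

noncomputable section

open scoped Classical ComplexConjugate

open WeierstrassCurve

namespace Literature.NumberTheory.EllipticCurves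

open QuadraticFields.GaussianPrimary GaussianQuartic

/-! ### The reduction of a `j = 1728` curve is `y² = x³ − Dx` with `48 D ≡ c₄` -/

/-- For a globally minimal `W/ℚ` with `j(W) = 1728` and a prime `p ≥ 5` of good reduction, the
reduction of `W` modulo `p` is `𝔽_p`-isomorphic to `y² = x³ − Dx` for some `D ∈ ℤ` with `p ∤ D` and
**`48 D ≡ c₄(W) (mod p)`**, `c₄(W)` the `c₄`-invariant of the minimal model; in particular they have
the same number of `𝔽_p`-points. (Refines the tree's `exists_natCard_reduction_eq_of_j_eq`: Mathlib's
`toShortNF` has `u = 1`, so `c₄` is unchanged, and `c₄ = −48 a₄` in short form.) [folklore] -/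
theorem exists_natCard_reduction_eq_of_j_eq' (W : WeierstrassCurve ℚ) [W.IsElliptic]
    [W.IsGloballyMinimal] (hj : W.j = 1728) {p : ℕ} [Fact p.Prime] (h2 : (2 : ZMod p) ≠ 0)
    (h3 : (3 : ZMod p) ≠ 0) (hΔ : ¬ (p : ℤ) ∣ minimalDiscriminantInt W) :
    ∃ D : ℤ, ¬ (p : ℤ) ∣ D ∧ (48 : ZMod p) * (D : ZMod p) = (((integralModelInt W).c₄ : ℤ) : ZMod p) ∧
      reductionPointCount W p =
        Nat.card (⟨0, 0, 0, -(D : ZMod p), 0⟩ : WeierstrassCurve (ZMod p)).toAffine.Point := by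
  set E : WeierstrassCurve (ZMod p) := (integralModelInt W).map (Int.castRingHom (ZMod p)) with hE
  have hEΔ : E.Δ = ((minimalDiscriminantInt W : ℤ) : ZMod p) := by
    rw [hE, map_Δ, eq_intCast]; rfl
  have hΔ0 : E.Δ ≠ 0 := by
    rwa [hEΔ, Ne, ZMod.intCast_zmod_eq_zero_iff_dvd]
  haveI : E.IsElliptic := by rw [isElliptic_iff, isUnit_iff_ne_zero]; exact hΔ0
  -- `j(E) = 1728`
  have hc4 : E.c₄ ^ 3 = E.Δ * 1728 := by
    have h := congrArg (Int.castRingHom (ZMod p)) (c₄_pow_three_eq_of_j_eq W hj)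
    rw [map_pow, map_mul] at h
    rw [hE, map_c₄, map_Δ, h, mul_comm]
    simp
  have hjE : E.j = 1728 := by
    rw [j, Units.val_inv_eq_inv_val, coe_Δ', hc4, ← mul_assoc, inv_mul_cancel₀ hΔ0, one_mul]
  -- short Weierstrass form
  haveI : Invertible (2 : ZMod p) := invertibleOfNonzero h2
  haveI : Invertible (3 : ZMod p) := invertibleOfNonzero h3
  set C := E.toShortNF with hC
  have hj' : (C • E).j = 1728 := by rw [variableChange_j, hjE]
  have ha₆ : (C • E).a₆ = 0 := a₆_eq_zero_of_j_eq (C • E) h2 h3 hj'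
  set D : ℤ := -(((C • E).a₄).val : ℤ) with hD
  have hDp : (D : ZMod p) = -(C • E).a₄ := by
    rw [hD]; push_cast; rw [ZMod.natCast_zmod_val]
  have hCE : C • E = ⟨0, 0, 0, -(D : ZMod p), 0⟩ := by
    rw [hDp, neg_neg]
    ext
    · exact (C • E).a₁_of_isShortNF
    · exact (C • E).a₂_of_isShortNF
    · exact (C • E).a₃_of_isShortNF
    · rfl
    · exact ha₆
  have ha₄ : (C • E).a₄ ≠ 0 := by
    intro h0
    have : (C • E).Δ = 0 := by rw [(C • E).Δ_of_isShortNF, h0, ha₆]; ring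
    exact (C • E).Δ'.ne_zero (by rw [coe_Δ']; exact this)
  -- `c₄` is preserved and equals `-48 a₄`
  have hCu : E.toShortNF.u = 1 := by
    simp [toShortNF, toCharNeTwoNF, VariableChange.mul_def]
  have hc₄E : (C • E).c₄ = E.c₄ := by
    rw [variableChange_c₄, hC, hCu]; simp
  have hc₄W : E.c₄ = (((integralModelInt W).c₄ : ℤ) : ZMod p) := by
    rw [hE, map_c₄, eq_intCast]
  refine ⟨D, ?_, ?_, ?_⟩
  · rw [← ZMod.intCast_zmod_eq_zero_iff_dvd, hDp, neg_eq_zero]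
    exact ha₄
  · rw [← hc₄W, ← hc₄E, (C • E).c₄_of_isShortNF, hDp]; ring
  · rw [reductionPointCount, ← hE, Nat.card_congr (VariableChange.pointEquiv E C).toEquiv, hCE]

/-! ### `p ≡ 3 (mod 4)`: `a_p = 0` -/

/-- **`a_p(W) = 0` at a good prime `p ≡ 3 (mod 4)`, `p ≠ 3`, of a globally minimal `W/ℚ` with
`j(W) = 1728`** (Ireland–Rosen 18.5, first assertion: `N_p = p + 1` for `y² = x³ − Dx`, `p ∤ 2D`,
`p ≡ 3 (4)`; the reduction is such a curve). [cite: IrelandRosen1990, Ch. 18 §4, Theorem 5 (first assertion)] -/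
theorem frobeniusTrace_eq_zero_of_j_eq_of_mod_four_eq_three (W : WeierstrassCurve ℚ) [W.IsElliptic]
    [W.IsGloballyMinimal] (hj : W.j = 1728) {p : ℕ} (hp : p.Prime) (hp3 : p % 4 = 3) (h3 : p ≠ 3)
    (hΔ : ¬ (p : ℤ) ∣ minimalDiscriminantInt W) : W.frobeniusTrace p = 0 := by
  haveI : Fact p.Prime := ⟨hp⟩
  have hp2 : p ≠ 2 := by rintro rfl; norm_num at hp3
  have h2' : (2 : ZMod p) ≠ 0 := by
    intro h0
    have h0' : ((2 : ℕ) : ZMod p) = 0 := by exact_mod_cast h0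
    rw [ZMod.natCast_eq_zero_iff] at h0'
    exact hp2 ((Nat.prime_dvd_prime_iff_eq hp Nat.prime_two).mp h0')
  have h3' : (3 : ZMod p) ≠ 0 := by
    intro h0
    have h0' : ((3 : ℕ) : ZMod p) = 0 := by exact_mod_cast h0
    rw [ZMod.natCast_eq_zero_iff] at h0'
    exact h3 ((Nat.prime_dvd_prime_iff_eq hp Nat.prime_three).mp h0')
  obtain ⟨D, hD, -, hcount⟩ := exists_natCard_reduction_eq_of_j_eq' W hj h2' h3' hΔ
  rw [frobeniusTrace, hcount, IrelandRosen1990_card_points_three_mod_four hp3 hD]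
  push_cast
  ring

/-! ### `p ≡ 1 (mod 4)`: `a_p² = 2 (3c₄/p) Re(π²) + 2p` -/

/-- For a unit `u` of `ℤ[i]` and any `π`: `(2 Re(uπ))² = 2 Re(u² π²) + 2 N(π)` (as integers), and
`u² = ±1` is real: `Re(u²π²) = Re(u²) Re(π²)`. [folklore] -/
theorem sq_two_mul_re_unit_mul {u : GaussianInt} (hu : IsUnit u) (π : GaussianInt) :
    (2 * (u * π).re) ^ 2 = 2 * (u ^ 2).re * (π ^ 2).re + 2 * π.norm := by
  rcases eq_of_isUnit hu with rfl | rfl | rfl | rfl <;>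
    simp [Zsqrtd.norm_def, sq] <;> ring

/-- **The square of the Frobenius trace at a split prime of a `j = 1728` curve.** For a globally
minimal `W/ℚ` with `j(W) = 1728`, a good prime `p ≡ 1 (mod 4)` and the primary Gaussian prime `π`
of norm `p` (`π ≡ 1 (2 + 2i)`): `a_p(W)² = 2 (3c₄(W)/p) Re(π²) + 2p`, with `(·/p)` the Legendre symbol
and `c₄(W)` the `c₄`-invariant of the minimal model. From Ireland–Rosen 18.5
(`a_p = \overline{χ_π(D)}π + χ_π(D)π̄` for the reduction `y² = x³ − Dx`), `χ_π(D)² = (D/p)` and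
`48 D ≡ c₄(W)`, `(48D/p) = (3D/p)·(16/p) = (3/p)(D/p)`. [cite: IrelandRosen1990, Ch. 18 §4, Theorem 5 (second assertion)] -/
theorem frobeniusTrace_sq_of_j_eq_of_mod_four_eq_one (W : WeierstrassCurve ℚ) [W.IsElliptic]
    [W.IsGloballyMinimal] (hj : W.j = 1728) {p : ℕ} [Fact p.Prime] (hp1 : p % 4 = 1)
    (hΔ : ¬ (p : ℤ) ∣ minimalDiscriminantInt W) {π : GaussianInt} (hπp : π.norm = p)
    (hπ : IsPrimary π) :
    W.frobeniusTrace p ^ 2 =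
      2 * legendreSym p (3 * (integralModelInt W).c₄) * (π ^ 2).re + 2 * p := by
  have hp : p.Prime := Fact.out
  have h2' : (2 : ZMod p) ≠ 0 := two_ne_zero_of_one_mod_four hp1
  have h5 := five_le hp1
  have h3' : (3 : ZMod p) ≠ 0 := by
    intro h0
    have h0' : ((3 : ℕ) : ZMod p) = 0 := by exact_mod_cast h0
    rw [ZMod.natCast_eq_zero_iff] at h0'
    have := Nat.le_of_dvd (by norm_num) h0'
    omega
  obtain ⟨D, hD, h48, hcount⟩ := exists_natCard_reduction_eq_of_j_eq' W hj h2' h3' hΔ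
  have hπ1 : (⟨2, 2⟩ : GaussianInt) ∣ π - 1 := (isPrimary_iff_dvd π).mp hπ
  -- `χ_π(D) = i^k`
  have hD0 : ((D : ℤ) : ZMod p) ≠ 0 := by rwa [Ne, ZMod.intCast_zmod_eq_zero_iff_dvd]
  obtain ⟨k, hk⟩ : ∃ k : ℕ, chi hp1 hπp (D : ZMod p) = ⟨0, 1⟩ ^ k := by
    rcases eq_of_isUnit (isUnit_chi hp1 hπp hD0) with h | h | h | h
    · exact ⟨0, by rw [h, pow_zero]⟩
    · exact ⟨2, by rw [h]; decide⟩
    · exact ⟨1, by rw [h, pow_one]⟩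
    · exact ⟨3, by rw [h]; decide⟩
  have hkdvd : π ∣ (D : GaussianInt) ^ ((p - 1) / 4) - ⟨0, 1⟩ ^ k := by
    apply dvd_of_red_eq_zero hπp
    have hred := (chi_eq_iff hp1 hπp hD0 (isUnit_I.pow k)).mp hk
    rw [map_sub, map_pow, map_intCast, show (p - 1) / 4 = p / 4 by omega, ← hred, sub_self]
  -- Ireland–Rosen 18.5: `N_p = p + 1 − 2 Re(conj(i^k) π)`
  have hN := IrelandRosen1990_card_points_one_mod_four_holds hp1 hD hπp hπ1 hkdvd
  rw [← hcount] at hN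
  set u : GaussianInt := star ((⟨0, 1⟩ : GaussianInt) ^ k) with hu
  have huu : IsUnit u := (isUnit_I.pow k).star
  have hft : W.frobeniusTrace p = 2 * (u * π).re := by
    rw [frobeniusTrace]
    linear_combination (-1 : ℤ) * hN
  -- `u² = conj(χ_π(D)²) = (D/p)`
  have hu2 : (u ^ 2).re = legendreSym p D := by
    have h1 : u ^ 2 = star (chi hp1 hπp (D : ZMod p) ^ 2) := by
      rw [hu, hk, ← star_pow, ← pow_mul]
    rw [h1, chi_sq hp1 hπp, star_rho, rho_apply, legendreSym]
    simp
  -- `(D/p) = (3c₄/p)`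
  have hleg : legendreSym p D = legendreSym p (3 * (integralModelInt W).c₄) := by
    have hc : (((3 * (integralModelInt W).c₄ : ℤ) : ℤ) : ZMod p) = (((144 * D : ℤ) : ℤ) : ZMod p) := by
      push_cast; rw [← h48]; ring
    have h144 : legendreSym p (144 * D) = legendreSym p D := by
      rw [show (144 : ℤ) * D = 12 ^ 2 * D by ring, legendreSym.mul, legendreSym.sq_one', one_mul]
      intro h0
      have h0' : ((12 : ℕ) : ZMod p) = 0 := by exact_mod_cast h0
      rw [ZMod.natCast_eq_zero_iff] at h0'
      rcases (Nat.Prime.dvd_mul hp).mp (show p ∣ 4 * 3 from h0') with h | h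
      · rcases (Nat.Prime.dvd_mul hp).mp (show p ∣ 2 * 2 from h) with h' | h' <;>
          · have := (Nat.prime_dvd_prime_iff_eq hp Nat.prime_two).mp h'; omega
      · have := (Nat.prime_dvd_prime_iff_eq hp Nat.prime_three).mp h; omega
    rw [legendreSym.mod p (3 * _), show ((3 * (integralModelInt W).c₄ : ℤ)) % (p : ℤ) = (144 * D) % (p : ℤ) from
      (ZMod.intCast_eq_intCast_iff' _ _ _).mp hc, ← legendreSym.mod, h144]
  rw [hft, sq_two_mul_re_unit_mul huu, hu2, hleg, hπp]

end Literature.NumberTheory.EllipticCurves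

end
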